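import Literature.NumberTheory.EllipticCurves.EmertonPollackWeston2006.WeightKMembers
import HarnessLib

/-!
# Emerton–Pollack–Weston, *Variation of Iwasawa invariants in Hida families* (Invent. Math. 163
# (2006)): Thm. 3.1.1, Thm. 1 (`∗ = alg`, both directions) and Thm. 5.1.3 / Thm. 4.4.5 for the pair
# (`f_E`, a weight-`k` member `g` of `H(E[p])` of any tame level) when `E` has GOOD ORDINARY reduction
# at `p` — the good-ordinary twins of `WeightKMembers.lean` (named facts, D-0014)

Cell `bsd-smallim` (rung K6 of `BirchSwinnertonDyer`, class X9 = good ordinary `p ∈ {5, 7}`, `E[p]`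
irreducible with non-surjective image), seat `bsd-smallim-k6-ty` (typer).  HONEST FRAMING: named facts
(`def … : Prop`, nothing asserted, no `_holds`), one bookkeeping theorem; BSD is not advanced; the
consumer (the second line under item 19630 `AnalyticMuZeroX9`, "EPW residual rigidity",
HOME/koly/KOLY-MEMO.md §5.9 and plan/k6/ideas/idea-epw-residual-mu-transfer.md) gets NAMED inputs so that
the class statement "`μ^an(f_E) = 0` on X9" reduces per `ρ̄`-piece to ONE structured member of
`H(ρ̄)` with `μ = 0`; nothing is closed here.

The companion `WeightKMembers.lean` (cell `b2b-bsdres`, class X11a) vendors the SAME printed theorems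
for `E` with MULTIPLICATIVE reduction at `p` (the member `g` of level `N/p`, and its `_ofLevel` twins
for any tame level `M`, `p ∤ M`); `MuAnTransferGoodOrdinary.lean` vendors Thm. 1 (`∗ = an`) between two
good-ordinary CURVES and records "`-- TODO(general form): … all weights … and ∗ = alg`".  This file is
that general form on the algebraic side and for Thm. 5.1.3, for a good-ordinary curve and a
higher-weight member: the statements below are the `_ofLevel` twins of `WeightKMembers.lean` with the
`E`-side hypothesis `p ‖ N` replaced by good ordinary reduction and the `E`-side currencies replaced
accordingly (no trivial-zero factor `T^e`; the good-reduction `p`-adic `L`-function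
`padicLFunction f (unitRoot W p)`), everything on the member side BYTE-IDENTICAL.  Thm. 3.1.1 concerns
the member alone, so it is vendored ONCE with no hypothesis on the reduction of `E` at `p`
(`thm311_cotorsion_weightK_member_anyReduction`), and the multiplicative `_ofLevel` twin is DERIVED
from it (`thm311_cotorsion_weightK_member_ofLevel_of_anyReduction`).

## Source (arXiv:math/0404484 = `paper:arxiv-math_0404484`, chunks = pages below; re-read 2026-08-26)

* p. 2 (VERBATIM): "Let `ρ̄ : G_ℚ → GL₂(k)` be an absolutely irreducible modular Galois representation
  over a finite field `k` of characteristic `p`. Assume further that `ρ̄` is `p`-ordinary and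
  `p`-distinguished in the sense that the restriction of `ρ̄` to a decomposition group at `p` is
  reducible and non-scalar. The Hida family `H(ρ̄)` of `ρ̄` is the set of all `p`-ordinary
  `p`-stabilized newforms `f` with mod `p` Galois representation isomorphic to `ρ̄`. (If `ρ̄` is
  unramified at `p`, then one must also fix an unramified line in `ρ̄` and require that the ordinary
  line of `f` reduces to this fixed line.) … **Theorem 1.** Fix `∗ ∈ {alg, an}`. If `μ^∗(f₀) = 0` for
  some `f₀ ∈ H(ρ̄)`, then `μ^∗(f) = 0` for all `f ∈ H(ρ̄)`. (We then write simply `μ^∗(ρ̄) = 0`.)"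
* p. 17, Thm. 3.1.1 (VERBATIM): "Let `f` be a `p`-ordinary and `p`-stabilized newform with `ρ̄_f`
  absolutely irreducible. Then `Sel(ℚ_∞, A_{f,i})` is co-finitely generated, `Λ_𝒪`-cotorsion, and has
  no proper `Λ_𝒪`-submodules of finite index. Furthermore, `μ^alg(f, ω^i)` vanishes if and only if
  `Sel(ℚ_∞, A_{f,i})[π]` is finite."  (§3.1 opens with a newform of ANY tame level `N`, weight
  `k ≥ 2`, character `χ`.)
* p. 24, Thm. 4.4.5 and Def. 4.4.6; p. 30, Thm. 5.1.3 (VERBATIM): "Let `k` be a finite field of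
  characteristic `p` and let `ρ̄ : G_ℚ → GL₂(k)` be an irreducible, modular, `p`-ordinary and
  `p`-distinguished representation; as always we fix a choice of `p`-stabilization. Suppose that
  `μ^alg(f₀,ω^i) = μ^an(f₀,ω^i) = 0` and `λ^alg(f₀,ω^i) = λ^an(f₀,ω^i)` for some `f₀` in the Hida
  family attached to `ρ̄` and some `i`. Then `μ^alg(f,ω^i) = μ^an(f,ω^i) = 0` and
  `λ^alg(f,ω^i) = λ^an(f,ω^i)` for every `f` in the Hida family attached to `ρ̄`."; Cor. 5.1.4 (ibid.).

## Faithfulness of the good-ordinary instance (bridges)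

* `ρ̄ = E[p]`, `E` good ordinary at `p ≥ 5`, `E[p]` irreducible: absolutely irreducible (odd,
  irreducible, `p > 2`); `p`-ordinary (`E[p]|_{D_p}` has the unramified quotient `Ẽ[p]`); RAMIFIED at `p`
  and `p`-distinguished (the sub-character restricted to inertia is `ω ≠ 1`, the quotient is unramified
  — the two characters differ), so the parenthetical "unramified at `p`" clause of p. 2 is void; `f_E`
  (its ordinary `p`-stabilisation) is a member of `H(E[p])`; `(g, ι)` with `IsOrdinaryMemberOfLevel W p g ι`
  (congruence of all `a_ℓ`, `ℓ ∤ N·M`, Brauer–Nesbitt–Chebotarev) is a member of weight `k > 2`,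
  `k ≡ 2 (mod p − 1)`, trivial character, tame level `M` — a SUB-family of `H(ρ̄)` (special case).
* `E`-side currencies at GOOD ORDINARY `p`: EPW's `Sel(ℚ_∞, A_{f_E})` (Greenberg) IS the classical
  `Sel_{p^∞}(E/ℚ_∞)` (Greenberg, LNM 1716, §2 Props. 2.1–2.4: at a good ordinary prime the Greenberg
  condition is the Kummer condition), so `μ^alg(f_E) = 0` ⟺ "`X(E/ℚ_∞)` is `Λ`-torsion with `μ = 0`"
  for the tree's `W.SelmerDualData` (`D.IsTorsion ∧ D.mu = 0`), and `λ^alg(f_E) = λ(fE)` for a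
  generator `fE` of `D.charIdeal` — NO trivial-zero factor (contrast `WeightKMembers.lean`, `T^e`).
  EPW's `L_p^an(f_E)` (canonical period) and the Néron-normalised `ϖ · padicLFunction f (unitRoot W p)`
  (`ϖ · Ω_E = Ω⁺_f`) differ by a `p`-adic unit under `Irr(E[p])` (Greenberg–Vatsal 2000 §3 Prop. (3.1),
  Rem. (3.4), Lemma (3.6), Prop. (3.7) — the reading of `MuAnTransferGoodOrdinary.lean` and of
  `HidaFamilyTransfer.GoodOrdinaryCharIdealMuZero`), so `μ^an(f_E) = 0` ⟺ some coefficient of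
  `ϖ · L_p(f, α)` is a unit, and `λ^an(f_E) = normLam gK` for `ι gK = ϖ · L_p(f, α)`
  (`gK ∈ Λ` exists under irreducibility, GV Prop. 3.7; it is a BINDER here).
* Member side: verbatim `WeightKMembers.lean` (its module docstring, "g-side"), including the flag
  `EPW-canonical-period`: `μ^an(g) = 0` is supplied inside Thm. 5.1.3 in the equivalent form
  `μ^an(f_E) = 0` (Thm. 4.4.5), and `λ^an(g)` is `normLam` of THE bounded interpolant
  (`IsCycPAdicLFunctionWeightK` + boundedness).

Weaker than print, never stronger: one good-ordinary weight-two member and the trivial-character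
weight-`k ≡ 2 (p−1)` members only, `5 ≤ p`, `i = 0`.  `-- TODO(general form)` lines record the rest.

## References

* M. Emerton, R. Pollack, T. Weston, Invent. Math. 163 (2006) 523–580 = arXiv:math/0404484: p. 2
  (Thm. 1, `H(ρ̄)`), p. 17 (§3.1, Thm. 3.1.1), p. 24 (Thm. 4.4.5, Def. 4.4.6), p. 30 (Thm. 5.1.3,
  Cor. 5.1.4). [EmertonPollackWeston2006]
* R. Greenberg, LNM 1716 (1999), §2 Props. 2.1–2.4. [GreenbergLNM1716]
* R. Greenberg, V. Vatsal, Invent. Math. 142 (2000), §3. [GreenbergVatsal2000]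
* Tree: `EmertonPollackWeston2006/WeightKMembers.lean` (the multiplicative twins and all member-side
  vocabulary: `IsOrdinaryMemberOfLevel`, `OrdinaryPadicData`, `GreenbergSelmer.DualData`,
  `IsCycPAdicLFunctionWeightK`, `normLam`), `MuAnTransferGoodOrdinary.lean`, `HidaFamilyTransfer.lean`.
-/

noncomputable section

open scoped Classical MatrixGroups ModularForm

open NumberField IsDedekindDomain Field CongruenceSubgroup
open Literature.NumberTheory.GaloisRepresentations
open Literature.NumberTheory.EllipticCurves.ModularForms
open Literature.NumberTheory.EllipticCurves.GreenbergVatsal2000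

namespace Literature.NumberTheory.EllipticCurves.EmertonPollackWeston2006

/-- **Emerton–Pollack–Weston 2006, Thm. 3.1.1 (cotorsion; [Kato], [KKT]) for a weight-`k` member of
`H(E[p])` of ANY tame level prime to `p`, with NO hypothesis on the reduction of `E` at `p`.**
"Let `f` be a `p`-ordinary and `p`-stabilized newform with `ρ̄_f` absolutely irreducible. Then
`Sel(ℚ_∞, A_f)` is co-finitely generated, `Λ_𝒪`-cotorsion" (arXiv:math/0404484 p. 17).  The theorem
concerns the MEMBER only: `E/ℚ` (globally minimal `W`) enters solely to certify, through
`IsOrdinaryMemberOfLevel W p g ι` (`ρ̄_{g,ι} ≅ E[p]`) and `W.HasIrreducibleModPGaloisRep p` at `p ≥ 5`,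
that `ρ̄_g` is absolutely irreducible; hence no reduction hypothesis on `E` at `p` is needed, and both
the multiplicative twin `thm311_cotorsion_weightK_member_ofLevel` and the good-ordinary case follow
(`thm311_cotorsion_weightK_member_ofLevel_of_anyReduction`).  Instance: `5 ≤ p`, `E[p]` irreducible;
`M` with `p ∤ M`; `(g, ι)` an ordinary member of level `M`; for ALL ordinary `p`-adic data `𝔇`, the
cyclotomic `κ` with topological generator `γ`, and every `Λ_𝒪`-dual datum `D` of Greenberg's
`Sel(ℚ_∞, A_g)`: `D.X` is finitely generated and torsion over `Λ_𝒪`.  Named fact; nothing asserted.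
-- TODO(general form): any p-ordinary p-stabilised newform with ρ̄ absolutely irreducible, twists ω^i,
-- and the clauses "no proper finite-index submodule", "μ^alg = 0 ⟺ Sel[π] finite".
[cite: EmertonPollackWeston2006, Thm. 3.1.1 and §3.1 (arXiv:math/0404484 p. 17), Intro p. 2 (H(ρ̄))] -/
def thm311_cotorsion_weightK_member_anyReduction : Prop :=
  ∀ (W : WeierstrassCurve ℚ) [W.IsElliptic] [W.IsGloballyMinimal] (p : ℕ) [Fact p.Prime],
    5 ≤ p → W.HasIrreducibleModPGaloisRep p →
    ∀ {M : ℕ} [NeZero M], ¬ p ∣ M → ∀ {k : ℤ} (g : CuspForm (Gamma0 M) k)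
      (ι : coeffField g →+* PadicAlgCl p), IsOrdinaryMemberOfLevel W p g ι →
    ∀ (𝔇 : OrdinaryPadicData g p ι) (κ : ZpExtension ℚ p) (γ : Field.absoluteGaloisGroup ℚ),
      κ.IsCyclotomic → κ.IsTopGenerator γ →
    ∀ (D : GreenbergSelmer.DualData (padicCoeffField (memberGenerators g ι 𝔇.υ)) κ γ 𝔇.ρ 𝔇.plus),
      Module.Finite (PowerSeries (padicCoeffIntegers (memberGenerators g ι 𝔇.υ))) D.X ∧
        Module.IsTorsion (PowerSeries (padicCoeffIntegers (memberGenerators g ι 𝔇.υ))) D.X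

/-- The multiplicative twin `thm311_cotorsion_weightK_member_ofLevel` of `WeightKMembers.lean` follows
from the reduction-free statement (drop the unused hypothesis `p ‖ N`). Bookkeeping only.
[cite: EmertonPollackWeston2006, Thm. 3.1.1 (arXiv:math/0404484 p. 17)] -/
theorem thm311_cotorsion_weightK_member_ofLevel_of_anyReduction
    (h : thm311_cotorsion_weightK_member_anyReduction) : thm311_cotorsion_weightK_member_ofLevel := by
  intro W _ _ p _ hp _ hirr M _ hM k g ι hmem 𝔇 κ γ hκ hγ D
  exact h W p hp hirr hM g ι hmem 𝔇 κ γ hκ hγ D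

/-- **Emerton–Pollack–Weston 2006, Thm. 1 with `∗ = alg`, direction `f₀ = f_E ↦ f = g`, for `E`
GOOD ORDINARY at `p`.** "Fix `∗ ∈ {alg, an}`. If `μ^∗(f₀) = 0` for some `f₀ ∈ H(ρ̄)`, then
`μ^∗(f) = 0` for all `f ∈ H(ρ̄)`" (arXiv:math/0404484 p. 2; `ρ̄` absolutely irreducible,
`p`-ordinary, `p`-distinguished).  Instance (module docstring, bridges): `E/ℚ` globally minimal,
`5 ≤ p`, good ordinary at `p` (`HasGoodReductionAtPrime`, `p ∤ a_p`), `E[p]` irreducible;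
HYPOTHESIS `μ^alg(f_E) = 0` ("`X(E/ℚ_∞)` is `Λ`-torsion with `μ = 0` for every cyclotomic datum and
every dual datum" — Greenberg = classical Selmer at a good ordinary prime); CONCLUSION `μ^alg(g) = 0`
for every ordinary member `(g, ι)` of `H(E[p])` of tame level `M`, `p ∤ M`: for all ordinary `p`-adic
data, cyclotomic `(κ, γ)`, torsion dual data `D` and every generator `G` of `charIdeal(D)`, some
coefficient of `G` has `p`-adic norm `1`.  Member side byte-identical to
`thm1_muAlg_of_weightK_member_ofLevel`.  Named fact; nothing asserted.
-- TODO(general form): Thm. 1 for arbitrary pairs f₀, f ∈ H(ρ̄), twists ω^i, ∗ = an via canonical periods.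
[cite: EmertonPollackWeston2006, Thm. 1 and Intro p. 2 (H(ρ̄)) (arXiv:math/0404484 p. 2) and §3.1 (p. 17)]
[cite: GreenbergLNM1716, §2 Props. 2.1–2.4] -/
def thm1_muAlg_of_weightK_member_goodOrdinary : Prop :=
  ∀ (W : WeierstrassCurve ℚ) [W.IsElliptic] [W.IsGloballyMinimal] (p : ℕ) [Fact p.Prime],
    5 ≤ p → W.HasGoodReductionAtPrime p → ¬ (p : ℤ) ∣ W.frobeniusTrace p →
    W.HasIrreducibleModPGaloisRep p →
    -- `μ^alg(f_E) = 0`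
    (∀ (κ : ZpExtension ℚ p) (γ : Field.absoluteGaloisGroup ℚ), κ.IsCyclotomic →
        κ.IsTopGenerator γ → IsCyclotomicVariable p γ →
        ∀ D : W.SelmerDualData κ γ, D.IsTorsion ∧ D.mu = 0) →
    ∀ {M : ℕ} [NeZero M], ¬ p ∣ M → ∀ {k : ℤ} (g : CuspForm (Gamma0 M) k)
      (ι : coeffField g →+* PadicAlgCl p), IsOrdinaryMemberOfLevel W p g ι →
    ∀ (𝔇 : OrdinaryPadicData g p ι) (κ : ZpExtension ℚ p) (γ : Field.absoluteGaloisGroup ℚ),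
      κ.IsCyclotomic → κ.IsTopGenerator γ → IsCyclotomicVariable p γ →
    ∀ (D : GreenbergSelmer.DualData (padicCoeffField (memberGenerators g ι 𝔇.υ)) κ γ 𝔇.ρ 𝔇.plus),
      Module.IsTorsion (PowerSeries (padicCoeffIntegers (memberGenerators g ι 𝔇.υ))) D.X →
    ∀ G : PowerSeries (padicCoeffIntegers (memberGenerators g ι 𝔇.υ)),
      D.charIdeal = Ideal.span {G} →
      ∃ n : ℕ, ‖((PowerSeries.coeff n G : padicCoeffIntegers (memberGenerators g ι 𝔇.υ)) :
        PadicAlgCl p)‖ = 1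

/-- **Emerton–Pollack–Weston 2006, Thm. 1 with `∗ = alg`, direction `f₀ = g ↦ f = f_E`, for `E` GOOD
ORDINARY at `p`** (the same printed sentence, p. 2, read in the opposite direction: the member `g` is
the source `f₀`, the curve's form `f_E` the target).  Instance as in
`thm1_muAlg_of_weightK_member_goodOrdinary`; HYPOTHESIS `μ^alg(g) = 0` for ONE ordinary member
`(g, ι)` of `H(E[p])` of tame level `M`, `p ∤ M`, in the member currency (for SOME ordinary `p`-adic
data `𝔇`, the cyclotomic `(κ, γ)`, SOME torsion dual datum `D` of `Sel(ℚ_∞, A_g)` and a generator `G`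
of `charIdeal(D)` with a coefficient of norm `1` — EPW's `μ^alg(g)` does not depend on these choices,
§3.1); CONCLUSION `μ^alg(f_E) = 0`: for all cyclotomic data `(κ', γ')` and every dual datum `D'` of
`Sel_{p^∞}(E/ℚ_∞)`, `D'.IsTorsion ∧ D'.mu = 0` (torsion = Thm. 3.1.1 at `f_E`).  This is the direction
the cell's 19630/19629 lines use (import `μ = 0` from a structured member, e.g. a CM form of
`H(E[p])`).  Named fact; nothing asserted.
-- TODO(general form): as above.
[cite: EmertonPollackWeston2006, Thm. 1 and Intro p. 2 (H(ρ̄)) (arXiv:math/0404484 p. 2), Thm. 3.1.1 and §3.1 (p. 17)]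
[cite: GreenbergLNM1716, §2 Props. 2.1–2.4] -/
def thm1_muAlg_of_curve_from_weightK_member_goodOrdinary : Prop :=
  ∀ (W : WeierstrassCurve ℚ) [W.IsElliptic] [W.IsGloballyMinimal] (p : ℕ) [Fact p.Prime],
    5 ≤ p → W.HasGoodReductionAtPrime p → ¬ (p : ℤ) ∣ W.frobeniusTrace p →
    W.HasIrreducibleModPGaloisRep p →
    ∀ {M : ℕ} [NeZero M], ¬ p ∣ M → ∀ {k : ℤ} (g : CuspForm (Gamma0 M) k)
      (ι : coeffField g →+* PadicAlgCl p), IsOrdinaryMemberOfLevel W p g ι →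
    ∀ (𝔇 : OrdinaryPadicData g p ι) (κ : ZpExtension ℚ p) (γ : Field.absoluteGaloisGroup ℚ),
      κ.IsCyclotomic → κ.IsTopGenerator γ → IsCyclotomicVariable p γ →
    ∀ (D : GreenbergSelmer.DualData (padicCoeffField (memberGenerators g ι 𝔇.υ)) κ γ 𝔇.ρ 𝔇.plus),
      Module.IsTorsion (PowerSeries (padicCoeffIntegers (memberGenerators g ι 𝔇.υ))) D.X →
    ∀ G : PowerSeries (padicCoeffIntegers (memberGenerators g ι 𝔇.υ)),
      D.charIdeal = Ideal.span {G} →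
    -- `μ^alg(g) = 0`
    (∃ n : ℕ, ‖((PowerSeries.coeff n G : padicCoeffIntegers (memberGenerators g ι 𝔇.υ)) :
        PadicAlgCl p)‖ = 1) →
    -- conclusion `μ^alg(f_E) = 0`
    ∀ (κ' : ZpExtension ℚ p) (γ' : Field.absoluteGaloisGroup ℚ), κ'.IsCyclotomic →
        κ'.IsTopGenerator γ' → IsCyclotomicVariable p γ' →
      ∀ D' : W.SelmerDualData κ' γ', D'.IsTorsion ∧ D'.mu = 0

/-- **Emerton–Pollack–Weston 2006, Thm. 5.1.3 with source `f₀ = g` and target `f = f_E` (Thm. 4.4.5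
for `μ^an`), bounded (print-faithful) interpolant, for `E` GOOD ORDINARY at `p`** — the good-ordinary
twin of `thm513_transfer_from_weightK_member_of_bdd_ofLevel`.  Thm. 5.1.3 (arXiv:math/0404484 p. 30):
"Suppose that `μ^alg(f₀,ω^i) = μ^an(f₀,ω^i) = 0` and `λ^alg(f₀,ω^i) = λ^an(f₀,ω^i)` for some `f₀` in
the Hida family attached to `ρ̄` and some `i`. Then `μ^alg(f,ω^i) = μ^an(f,ω^i) = 0` and
`λ^alg(f,ω^i) = λ^an(f,ω^i)` for every `f` in the Hida family attached to `ρ̄`"; Thm. 4.4.5 (p. 24):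
`μ^an` vanishes for one ordinary newform of the family iff for every one.  Instance: `E/ℚ` globally
minimal, `5 ≤ p`, GOOD ORDINARY at `p`, `E[p]` irreducible; source `(g, ι)` an ordinary member of
`H(E[p])` of tame level `M`, `p ∤ M`, with hypotheses (member currency, verbatim the multiplicative
twin) `μ^alg(g) = 0`, `λ^alg(g) = λ^an(g)` for THE bounded cyclotomic `p`-adic `L`-function of
`(g, ι, υ)`, and `μ^an(g) = 0` in the form `μ^an(f_E) = 0` (Thm. 4.4.5), Néron-normalised: some
coefficient of `ϖ · L_p(f, α)` is a unit (`ϖ · Ω_E = Ω⁺_f`, `α = unitRoot W p`); CONCLUSION at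
`f = f_E`, at every cyclotomic datum `(κ', γ')`, newform `f` of `W`, dual datum `D'`, generator `fE` of
`D'.charIdeal`, `ϖ` and every `gK ∈ Λ` with `ι gK = ϖ · L_p(f, α)`: `HasUnitContent gK ∧ HasUnitContent fE ∧
normLam gK = normLam fE` (`μ^an(f_E) = μ^alg(f_E) = 0` and `λ^an(f_E) = λ^alg(f_E)`, good-ordinary
bridges of the module docstring: no trivial-zero factor).  Flag `EPW-canonical-period` as in the twin.
Named fact; nothing asserted; no `_holds`.
-- TODO(general form): Thm. 5.1.3 for arbitrary f₀, f ∈ H(ρ̄), twists ω^i; μ^an via canonical periods;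
-- Cor. 5.1.4 ([MC] transfer) for such pairs.
[cite: EmertonPollackWeston2006, Thm. 5.1.3 (arXiv:math/0404484 p. 30), Thm. 4.4.5 and Def. 4.4.6 (p. 24), Thm. 1 and Intro p. 2 (H(ρ̄))]
[cite: GreenbergLNM1716, §2 Props. 2.1–2.4]
[cite: GreenbergVatsal2000, §3 Prop. (3.1), Remark (3.4), Lemma (3.6), Prop. (3.7)] -/
def thm513_transfer_from_weightK_member_goodOrdinary : Prop :=
  ∀ (W : WeierstrassCurve ℚ) [W.IsElliptic] [W.IsGloballyMinimal] (p : ℕ) [Fact p.Prime],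
    5 ≤ p → W.HasGoodReductionAtPrime p → ¬ (p : ℤ) ∣ W.frobeniusTrace p →
    W.HasIrreducibleModPGaloisRep p →
    ∀ {M : ℕ} [NeZero M], ¬ p ∣ M → ∀ {k : ℤ} (g : CuspForm (Gamma0 M) k)
      (ι : coeffField g →+* PadicAlgCl p), IsOrdinaryMemberOfLevel W p g ι →
    ∀ (𝔇 : OrdinaryPadicData g p ι) (κ : ZpExtension ℚ p) (γ : Field.absoluteGaloisGroup ℚ),
      κ.IsCyclotomic → κ.IsTopGenerator γ → IsCyclotomicVariable p γ →
    ∀ (D : GreenbergSelmer.DualData (padicCoeffField (memberGenerators g ι 𝔇.υ)) κ γ 𝔇.ρ 𝔇.plus),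
      Module.IsTorsion (PowerSeries (padicCoeffIntegers (memberGenerators g ι 𝔇.υ))) D.X →
    ∀ G : PowerSeries (padicCoeffIntegers (memberGenerators g ι 𝔇.υ)),
      D.charIdeal = Ideal.span {G} →
    ∀ (Dsym : PeriodSymbolDatum g) (L : PowerSeries (PadicAlgCl p)),
      IsCycPAdicLFunctionWeightK g Dsym p ι 𝔇.υ L →
      (∃ C : ℝ, ∀ i, ‖PowerSeries.coeff i L‖ ≤ C) →
    -- hypotheses of Thm. 5.1.3 at `f₀ = g`: `μ^alg(g) = 0`, `λ^alg(g) = λ^an(g)` …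
    (∃ n : ℕ, ‖((PowerSeries.coeff n G : padicCoeffIntegers (memberGenerators g ι 𝔇.υ)) :
        PadicAlgCl p)‖ = 1) →
    normLam (PowerSeries.map (padicCoeffIntegers (memberGenerators g ι 𝔇.υ)).subtype G) = normLam L →
    -- … and `μ^an(g) = 0` in the form `μ^an(f_E) = 0` (Thm. 4.4.5), Néron-normalised, good `p`
    (∀ {N : ℕ} [NeZero N] (f : CuspForm (Gamma0 N) 2), IsNewformOf W f →
        ∀ (ϖ : ℚ), (ϖ : ℝ) * W.realPeriodRat = plusPeriod f →
          ∃ n : ℕ, ‖PowerSeries.coeff n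
            (PowerSeries.C ((ϖ : ℚ) : ℚ_[p]) * padicLFunction f (unitRoot W p : ℚ_[p]))‖ = 1) →
    -- conclusion at `f = f_E`: `μ = 0` and `λ^alg(f_E) = λ^an(f_E)`, at every Kato pair
    ∀ (κ' : ZpExtension ℚ p) (γ' : Field.absoluteGaloisGroup ℚ),
        κ'.IsCyclotomic → κ'.IsTopGenerator γ' → IsCyclotomicVariable p γ' →
      ∀ {N : ℕ} [NeZero N] (f : CuspForm (Gamma0 N) 2), IsNewformOf W f →
      ∀ (D' : W.SelmerDualData κ' γ') (ϖ : ℚ), (ϖ : ℝ) * W.realPeriodRat = plusPeriod f →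
      ∀ (fE gK : IwasawaAlgebra p), D'.charIdeal = Ideal.span {fE} →
        iwasawaToPowerSeries p gK =
            PowerSeries.C ((ϖ : ℚ) : ℚ_[p]) * padicLFunction f (unitRoot W p : ℚ_[p]) →
          HasUnitContent gK ∧ HasUnitContent fE ∧ normLam gK = normLam fE

end Literature.NumberTheory.EllipticCurves.EmertonPollackWeston2006

end
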